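import Summits.QuantumFields.YangMills.Theorems.UnitScaleTiltHalvingHSiteTopH42Datum
import Summits.QuantumFields.YangMills.Theorems.UnitScaleTiltHalvingHSiteTopH42OfTower
import Summits.QuantumFields.YangMills.Theorems.UnitScaleTiltHalvingHSiteTopReadsFull
import HarnessLib

/-!
# Line H (`BirthV10.stub_halvingStep`, stmt-QuantumFields-19200): ★★★ THE `H42` SOCKET CLOSED AT THE MEMBER (ε₁-ROUTE) — ✓`HalvingHSiteSizeRowsOfTopRows.siteSizeRows_of_topRows`'
# Prop-3 (1.42) binder AT THE KNIT GAUGE of ✓`HalvingHSiteTopKnit.hknit_of_descent`, from J3's three rows, Theorem 4's datum rows, the top step's `λ′` rows, `PlaqSmall ε₁ V`,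
# `U ∈ regFibrePr`, and NUMERIC WINDOWS ONLY — no `H42` left to display

Cell `ym3-torus` (HUMAN RULING D-0037: YM₃ on T³ is ladder rung R3 — NOT d = 4, NOT a mass gap, NOT the Clay problem), width seat `ym-ust-20520-w3` gen 7 (variant (ii′) of the
LOCATE «H42-TOP-ε₁»).  `--supports stmt-QuantumFields-19200 --as helper`; THEOREMS ONLY (0 `def`, 0 `sorry`); count-neutral; nothing here claims `hMember`, `hSupUρ3`, the stub, the
crux or the gap.

THE POINT.  ✓`HalvingHSiteTopH42OfTower.H42_of_towerTop` is the reshaped socket's inhabitant with three rows displayed on the gauges (`htw` on `gJ`; `hreads`, `htop` on `g′`).  At the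
member the composers instantiate `gJ :=` J3's pre-gauge (which carries `htw`: ✓`HalvingP1FlatCorePreGaugeMember.exists_preGauge_chart_su` conjunct 4) and `g′ :=` the knit gauge of
Theorem 4's datum and the top step's `λ′`, at which `hreads` is (G5) ✓`HalvingHSiteTopReadsFull.topReadsFull_of_datum` (radius `r := e^{2α₄}((e^{c₁} − 1) + δ)`, `δ` the top-level
gradient bound of `λ′` = the composer's (1.108) row at `j = k`) and `htop` is ✓`HalvingHSiteTopH42Datum.htop_of_knitGauge` (`t := 2·d(M′+ρ′)·ε₁`).  ★★★ `H42_at_member`: the composition —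
conclusion = the `H42` ARGUMENT of ✓`siteSizeRows_of_topRows` at `Lan := IsLandau138W ∧ <knit clause at (U♯)^{g′}>` (the term the composers build as `H42 gJ hInAk hInAx g′`),
hypotheses = rows the composers HOLD + the numeric windows `hα₂ hkb hbudget hr hr2 hε₁l hwin` (window hand; `hr2`∕`hwin`∕`hε₁l` need `δ ≤ α₄L^{−k}`-class and `ε₁ ≲ L·ε₀`-class
smallness — the small-`Cr` exit of LEAD-H LOCATE-H42-TOP §2 (ii)).  HONEST SCOPE: three `exact`s; nothing of Prop. 3, Theorem 4 or the stub is proved here; whether the composers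
display the reshaped `H42` (✓`H42_of_towerTop`) or call this file is LEAD-H's (K-final) decision.

References: T. Bałaban, CMP **99** (1985) 75–102 [Balaban1985RegularSpaces] ((1.42) p.83, Prop. 3 p.87, (1.108) p.94, (1.131) p.99); CMP **98** (1985) 17–51 [Balaban1985Averaging]
((8) p.19, (97)–(100) p.32); CMP **102** (1985) 277–309 [Balaban1985Variational] ((152)–(156) pp.301–302).
-/

set_option autoImplicit false

noncomputable section

open scoped BigOperators Matrix.Norms.L2Operator
open NormedSpace
open Complex (I)

namespace Summit.QuantumFields.YangMills.Theorems.HalvingHSiteTopH42AtMember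

open Literature.MathematicalPhysics.QuantumFieldTheory.Balaban1983to89
open T4Continuum
open Literature.MathematicalPhysics.QuantumFieldTheory.Balaban1983to89.T3ContinuumYM3Torus
open Literature.MathematicalPhysics.QuantumFieldTheory.Balaban1983to89.T3PrintedRegularMinimiser (regFibrePr)
open MatrixLog (mlog)
open B5Eq118OneStroke (iterBlockOf)
open B7Prop1Explicit renaming Site → LSite
open B7Prop1Explicit (e)
open B7Prop2Explicit (unitaryUnits C0 c2' avgIter)
open B7Prop2SpecialUnitary (mem_specialUnitaryUnits specialUnitaryUnits_le_unitaryUnits)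
open B7Prop3Flat (c3)
open B7Prop4Flat (C2 c4)
open B7Prop1Local (InBox loK bondHiK)
open B7Eq92Concrete (mgauge)
open B8Ineq130 (tlo thi)
open B8Ineq132 (InAk)
open B8Eq119TwistedAxial (Restr129 InAx)
open B8Eq131Cubes (cube gs tLo tHi)
open B8Eq131CubesAdmissible (cubeFam)
open B8CubeMemberZd (cubeLamS cubeLamB)
open B8Eq184Proof (gaugeExp cfgExp)
open B8Eq140Level (SideTouches)
open B8Eq146AExpansion (iEta)
open B8Eq138LandauZd (IsLandau138W)
open B7Prop4GeneralLevels (logCovIter)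
open B10Eq27TorusAxialLog (rel pull unitsField toUField suIncl gaugeActT axialT)
open B15Eq112TorusCover (lift cover)
open Node00 (coverAt)
open Summit.QuantumFields.YangMills.Theorems.Prop8ChartDoubleBar (dbarIterU vframeU)
open Summit.QuantumFields.YangMills.Theorems (FlatMinimizerH.le_T3)
open HalvingHSiteTopH42Datum (htop_of_knitGauge ends_mem_cubeLamS_top)
open HalvingHSiteTopH42OfTower (H42_of_towerTop)
open HalvingHSiteTopReadsFull (topReadsFull_of_datum)
open HalvingHSiteTorusBlocks (rep_mem_cube_top_of_mem)
open P1FlatCoreTopLinearKnit (tgt_mk_coverAt)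

variable (F : T3Family) {n K : ℕ}

/-- ★★★ **THE `H42` SOCKET CLOSED AT THE MEMBER** — see the module docstring: ✓`H42_of_towerTop` ∘ (G5) ✓`topReadsFull_of_datum` ∘ ✓`htop_of_knitGauge`.  Hypotheses: the member
geometry `hρ′ ha hroomW`; `PlaqSmall ε₁ V`, `U ∈ regFibrePr … ε₀ V`; J3's rows `hInAk hInAx htw` for ITS gauge `gJ`; Theorem 4's datum rows `hu₁SU hW hc′ hbudget8 hc₁ hchartTop`;
F3's tower `hκfs hκf0`; the top step's `λ′` rows `hsa htr hlam0 hgrad` and its (top) row; the composer's Prop-3 windows and the knit∕read∕(1.42) windows.  Conclusion: the `H42`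
argument of ✓`HalvingHSiteSizeRowsOfTopRows.siteSizeRows_of_topRows` at the knit gauge. [cite: Balaban1985RegularSpaces, (1.42) p.83, Prop. 3 p.87, (1.108) p.94, (1.131) p.99; Balaban1985Averaging, (8) p.19, (97)-(100) p.32; Balaban1985Variational, (152)-(156) pp.301-302] -/
theorem H42_at_member (hnK : n < K) (x₀ : Site (F.P K) 0) {a : LSite (F.P K).d} {M' ρ' : ℕ} (hρ' : (F.P K).L ≤ ρ')
    (ha : ∀ ν, a ν ≤ ((iterBlockOf (K - n) x₀ ν).val : ℤ) ∧ ((iterBlockOf (K - n) x₀ ν).val : ℤ) ≤ a ν + M' - 1)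
    (hroomW : 2 * ((F.P K).L ^ (K - n) * (M' + 1) + ρ' * gs (F.P K).L (K - n)) ≤ (F.P K).sitesPerDir 0)
    {ε₀ ε₁ : ℝ} (hε₀ : 0 < ε₀) (hε : 10 ^ 7 * (F.L : ℝ) ^ 3 * ε₀ ≤ 1) (hε₁ : 0 ≤ ε₁)
    (V : GaugeField (F.P n) 0 (Matrix.specialUnitaryGroup (Fin 2) ℂ)) (hV : PlaqSmall ε₁ V)
    (U : GaugeField (F.P K) 0 (Matrix.specialUnitaryGroup (Fin 2) ℂ)) (hU : U ∈ regFibrePr F n K hnK.le ε₀ V)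
    -- J3's pre-gauge and its three rows
    (gJ : GaugeTransf (F.P K) 0 (Matrix.specialUnitaryGroup (Fin 2) ℂ)) {α₁ : ℝ}
    (hInAk : InAk (F.P K).L (K - n) (((F.L : ℝ)⁻¹) ^ (K - n)) ε₀ (fun _ => (Set.univ : Set (LSite (F.P K).d))) (pull (unitsField (toUField (GaugeField.gaugeAct gJ U))) 0))
    (hInAx : ∀ m', m' ≤ K - n → ∀ Λ : ℕ → Set (LSite (F.P K).d),
      InAx (F.P K).L m' Λ (1 : LSite (F.P K).d → Fin (F.P K).d → (Matrix (Fin 2) (Fin 2) ℂ)ˣ) (pull (unitsField (toUField (GaugeField.gaugeAct gJ U))) 0))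
    (htw : ∀ m', m' ≤ K - n → ∀ (x : LSite (F.P K).d) (ν : Fin (F.P K).d), tlo (F.P K).L (tLo a ρ') m' ≤ x → x + e ν ≤ thi (F.P K).L (tHi a M' ρ') m' →
      ‖((avgIter (F.P K).L (pull (unitsField (toUField (GaugeField.gaugeAct gJ U))) 0) (K - n - m') x ν : (Matrix (Fin 2) (Fin 2) ℂ)ˣ) :
          Matrix (Fin 2) (Fin 2) ℂ) - 1‖ < α₁)
    -- Theorem 4's datum in the member's letters
    {u₁ : LSite (F.P K).d → (Matrix (Fin 2) (Fin 2) ℂ)ˣ} {W : LSite (F.P K).d → Fin (F.P K).d → (Matrix (Fin 2) (Fin 2) ℂ)ˣ}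
    {A : LSite (F.P K).d → Fin (F.P K).d → Matrix (Fin 2) (Fin 2) ℂ}
    (hu₁SU : ∀ z, ((u₁ z : (Matrix (Fin 2) (Fin 2) ℂ)ˣ) : Matrix (Fin 2) (Fin 2) ℂ) ∈ Matrix.specialUnitaryGroup (Fin 2) ℂ)
    (hW : mgauge (1 : LSite (F.P K).d → Fin (F.P K).d → (Matrix (Fin 2) (Fin 2) ℂ)ˣ) u₁ W = pull (unitsField (toUField (GaugeField.gaugeAct gJ U))) 0)
    {c₁ c' : ℝ} (hc' : 0 ≤ c') (hbudget8 : 8 * 3800 * ((((F.P K).d + 2) * (F.P K).L : ℕ) : ℝ) ^ 2 * c' ≤ 1)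
    (hc₁ : Real.exp c₁ - 1 ≤ ((F.L : ℝ)⁻¹) ^ (K - n) * c')
    (hchartTop : ∀ z ∈ cube (F.P K).L a M' ρ' (K - n) (K - n), ∀ ν : Fin (F.P K).d,
      W z ν = cfgExp (((F.L : ℝ)⁻¹) ^ (K - n)) A z ν ∧ ((F.L : ℝ)⁻¹) ^ (K - n) * ‖A z ν‖ ≤ c₁)
    -- F3's effective-gauge tower over the pre-gauged field
    {κf : (Site (F.P K) 0 → Matrix (Fin 2) (Fin 2) ℂ) → (i : ℕ) → GaugeTransf (F.P K) i (Matrix (Fin 2) (Fin 2) ℂ)ˣ}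
    (hκfs : ∀ (m : Site (F.P K) 0 → Matrix (Fin 2) (Fin 2) ℂ) (i : ℕ) (y : Site (F.P K) (i + 1)),
      κf m (i + 1) y = (vframeU (gaugeActT (κf m i) (dbarIterU i (gaugeActT
        (fun s => (u₁ (lift (F.P K) x₀ + rel x₀ s))⁻¹ * Unitary.toUnits (suIncl (gJ s)) : GaugeTransf (F.P K) 0 (Matrix (Fin 2) (Fin 2) ℂ)ˣ)
        (unitsField (toUField U))))) y)⁻¹ * κf m i (emb y) *
        vframeU (dbarIterU i (gaugeActT
          (fun s => (u₁ (lift (F.P K) x₀ + rel x₀ s))⁻¹ * Unitary.toUnits (suIncl (gJ s)) : GaugeTransf (F.P K) 0 (Matrix (Fin 2) (Fin 2) ℂ)ˣ)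
          (unitsField (toUField U)))) y)
    (hκf0 : ∀ (m : Site (F.P K) 0 → Matrix (Fin 2) (Fin 2) ℂ) (x : Site (F.P K) 0), ((κf m 0 x : (Matrix (Fin 2) (Fin 2) ℂ)ˣ) : Matrix (Fin 2) (Fin 2) ℂ) = exp (m x))
    -- the top step's `λ′`: Hermitian traceless, `≤ α₄` on `□₀`, gradient `≤ δ` on `□_k`, and its (top) row
    {lam : LSite (F.P K).d → Matrix (Fin 2) (Fin 2) ℂ} {α₄ δ : ℝ} (hsa : ∀ x, IsSelfAdjoint (lam x)) (htr : ∀ x, (lam x).trace = 0)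
    (hlam0 : ∀ z ∈ cube (F.P K).L a M' ρ' (K - n) 0, ‖lam z‖ ≤ α₄)
    (hgrad : ∀ z ∈ cube (F.P K).L a M' ρ' (K - n) (K - n), ∀ ν : Fin (F.P K).d, ‖lam (z + e ν) - lam z‖ ≤ δ)
    (htopRow : ∀ yc ∈ cubeLamS (F.P K).L a M' ρ' (K - n) (K - n) (K - n),
      κf (((-I) • lam) ∘ fun s : Site (F.P K) 0 => lift (F.P K) x₀ + rel x₀ s) (K - n) (coverAt (F.P K) (K - n) yc) =
        axialT (dbarIterU (K - n) (gaugeActT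
          (fun s => (u₁ (lift (F.P K) x₀ + rel x₀ s))⁻¹ * Unitary.toUnits (suIncl (gJ s)) : GaugeTransf (F.P K) 0 (Matrix (Fin 2) (Fin 2) ℂ)ˣ)
          (unitsField (toUField U)))) (iterBlockOf (K - n) x₀) (coverAt (F.P K) (K - n) yc))
    -- the composer's Prop-3 windows (VERBATIM) and the knit ∕ read ∕ (1.42) windows (window hand)
    {cstar : ℝ} (hα₁ : 0 < α₁) (hα₂ : 0 ≤ 2 * ((F.P K).L * cstar) + 8 * α₄)
    (hα3 : C0 (F.P K).d * ε₀ ≤ 1 / 3) (hα4 : 4 * ε₀ ≤ c2' (F.P K).d (F.P K).L)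
    (h16 : 16 * (2 * ((F.P K).L * cstar) + 8 * α₄) ≤ 1)
    (hsmallP : Real.exp (4 * (800 * (((F.P K).d : ℝ) + 1) ^ 2 * (((F.P K).d : ℝ) + 4)) * ε₀)
      * (1 + 8 * (131072 * (((F.P K).d : ℝ) + 1) ^ 2) * (2 * ((F.P K).L * cstar) + 8 * α₄)) ≤ 2)
    (hc₃P : 2 * (2 * ((F.P K).L * cstar) + 8 * α₄) ≤ c3 (F.P K).d (F.P K).L) (hsmall₁ : ((F.P K).d : ℝ) * (F.P K).L * α₁ ≤ 1 / 8)
    (hkb : 2 * ((F.P K).L * cstar) + 8 * α₄ ≤ c4 (F.P K).d)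
    (hbudget : 243200 * ((((F.P K).d + 2) * (F.P K).L : ℕ) : ℝ) ^ 2 * (2 * ((F.P K).L * cstar) + 8 * α₄) ≤ 1)
    (hr : Real.exp (2 * α₄) * ((Real.exp c₁ - 1) + δ) ≤ 1 / 2)
    (hr2 : 2 * (Real.exp (2 * α₄) * ((Real.exp c₁ - 1) + δ)) ≤ (2 * ((F.P K).L * cstar) + 8 * α₄) * (((F.P K).L : ℝ) ^ (K - n))⁻¹)
    (hε₁l : 2 * ((((F.P K).d * (M' + ρ') : ℕ) : ℝ) * ε₁) ≤ 1)
    (hwin : 2 * ((((F.P K).d * (M' + ρ') : ℕ) : ℝ) * ε₁) +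
        (C2 (F.P K).d + 64 * 60800 * ((((F.P K).d + 2) * (F.P K).L : ℕ) : ℝ) ^ 2) * (2 * ((F.P K).L * cstar) + 8 * α₄) ^ 2 <
      2 * ((F.P K).d : ℝ) * (F.P K).L * α₁) :
    -- CONCLUSION: the `H42` argument of ✓`siteSizeRows_of_topRows` at the knit gauge (= the composers' `H42 gJ hInAk hInAx g′`)
    ∀ (u : LSite (F.P K).d → (Matrix (Fin 2) (Fin 2) ℂ)ˣ) (V' : LSite (F.P K).d → Fin (F.P K).d → (Matrix (Fin 2) (Fin 2) ℂ)ˣ)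
        (A' : LSite (F.P K).d → Fin (F.P K).d → (Matrix (Fin 2) (Fin 2) ℂ)),
      (∀ x, u x ∈ unitaryUnits (Matrix (Fin 2) (Fin 2) ℂ)) → mgauge (1 : LSite (F.P K).d → Fin (F.P K).d → (Matrix (Fin 2) (Fin 2) ℂ)ˣ) u V' = (pull (unitsField (toUField (GaugeField.gaugeAct gJ U))) 0) →
      Restr129 (F.P K).L (K - n) (Function.update (cubeLamS (F.P K).L a M' ρ' (K - n) (K - n)) (K - n) ∅) (1 : LSite (F.P K).d → Fin (F.P K).d → (Matrix (Fin 2) (Fin 2) ℂ)ˣ) u →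
      (IsLandau138W (F.P K).L (K - n) (((F.L : ℝ)⁻¹) ^ (K - n)) ((cubeFam false (F.P K).L a M' ρ' (K - n)) 0) (cubeLamS (F.P K).L a M' ρ' (K - n) (K - n)) (1 : LSite (F.P K).d → Fin (F.P K).d → (Matrix (Fin 2) (Fin 2) ℂ)ˣ) V' ∧
        (∀ c ∈ (cubeLamB (F.P K).L a M' ρ' (K - n) (K - n)) (K - n), ∀ (y : LSite (F.P K).d) (τ : Fin (F.P K).d),
          InBox (loK (F.P K).L (K - n) c.1) (bondHiK (F.P K).L (K - n) c.1 c.2) y → InBox (loK (F.P K).L (K - n) c.1) (bondHiK (F.P K).L (K - n) c.1 c.2) (y + e τ) →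
          V' y τ = gaugeActT (fun s => ((u₁ * gaugeExp lam) (lift (F.P K) x₀ + rel x₀ s))⁻¹ * Unitary.toUnits (suIncl (gJ s)) :
            GaugeTransf (F.P K) 0 (Matrix (Fin 2) (Fin 2) ℂ)ˣ) (unitsField (toUField U)) ⟨cover (F.P K) y, τ⟩)) →
      (∀ y τ, IsSelfAdjoint (A' y τ)) →
      (∀ j, j ≤ K - n → ∀ y τ, SideTouches ((cubeFam false (F.P K).L a M' ρ' (K - n)) j) y τ →
        V' y τ = cfgExp (((F.L : ℝ)⁻¹) ^ (K - n)) A' y τ ∧ ‖A' y τ‖ ≤ (2 * ((F.P K).L * cstar) + 8 * α₄) * (((F.P K).L : ℝ) ^ j * (((F.L : ℝ)⁻¹) ^ (K - n)))⁻¹) →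
      (∀ y τ, (∀ j, j ≤ K - n → ¬ SideTouches ((cubeFam false (F.P K).L a M' ρ' (K - n)) j) y τ) → A' y τ = 0) →
      ∀ j, j ≤ K - n → ∀ c ∈ (cubeLamB (F.P K).L a M' ρ' (K - n) (K - n)) j, ‖logCovIter (F.P K).L (1 : LSite (F.P K).d → Fin (F.P K).d → (Matrix (Fin 2) (Fin 2) ℂ)ˣ) (iEta (((F.L : ℝ)⁻¹) ^ (K - n)) A') j c.1 c.2‖ < 2 * (F.P K).d * (F.P K).L * α₁ := by
  have hk : K - n ≤ (F.P K).m + (F.P K).K := FlatMinimizerH.le_T3 F n K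
  have hL1 : 1 ≤ (F.P K).L := (F.P K).L_pos
  have hρ'1 : 1 ≤ ρ' := hL1.trans hρ'
  have hL0 : (0 : ℝ) < (F.L : ℝ) := by have := F.hL.2; exact_mod_cast (by omega : 0 < F.L)
  have hη0 : (0 : ℝ) ≤ ((F.L : ℝ)⁻¹) ^ (K - n) := pow_nonneg (inv_nonneg.2 hL0.le) _
  have hu₁ : ∀ x, u₁ x ∈ unitaryUnits (Matrix (Fin 2) (Fin 2) ℂ) :=
    fun x => specialUnitaryUnits_le_unitaryUnits (mem_specialUnitaryUnits.2 (hu₁SU x))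
  -- the reads row: (G5) at the member, on ✓`H42_top_guarded`'s reads (both `k`-blocks are top labels ⇒ representative in `□_k`)
  have hreads : ∀ c ∈ (cubeLamB (F.P K).L a M' ρ' (K - n) (K - n)) (K - n), ∀ b : PBond (F.P K) 0,
      (iterBlockOf (K - n) b.src = (⟨coverAt (F.P K) (K - n) c.1, c.2⟩ : PBond (F.P K) (K - n)).src ∨
        iterBlockOf (K - n) b.src = (⟨coverAt (F.P K) (K - n) c.1, c.2⟩ : PBond (F.P K) (K - n)).tgt) →
      (iterBlockOf (K - n) b.tgt = (⟨coverAt (F.P K) (K - n) c.1, c.2⟩ : PBond (F.P K) (K - n)).src ∨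
        iterBlockOf (K - n) b.tgt = (⟨coverAt (F.P K) (K - n) c.1, c.2⟩ : PBond (F.P K) (K - n)).tgt) →
      ‖((gaugeActT (fun s => ((u₁ * gaugeExp lam) (lift (F.P K) x₀ + rel x₀ s))⁻¹ * Unitary.toUnits (suIncl (gJ s)) :
          GaugeTransf (F.P K) 0 (Matrix (Fin 2) (Fin 2) ℂ)ˣ) (unitsField (toUField U)) b : (Matrix (Fin 2) (Fin 2) ℂ)ˣ) : Matrix (Fin 2) (Fin 2) ℂ) - 1‖ ≤
        Real.exp (2 * α₄) * ((Real.exp c₁ - 1) + δ) := by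
    intro c hc b hbs _
    obtain ⟨hc1mem, hc2mem⟩ := ends_mem_cubeLamS_top hL1 a M' ρ' (K - n) hc
    have hT : iterBlockOf (K - n) b.src ∈ {B : Site (F.P K) (K - n) | ∃ yc ∈ cubeLamS (F.P K).L a M' ρ' (K - n) (K - n) (K - n), B = coverAt (F.P K) (K - n) yc} := by
      rcases hbs with h | h
      · exact ⟨c.1, hc1mem, h⟩
      · exact ⟨c.1 + e c.2, hc2mem, h.trans (tgt_mk_coverAt _ _ _)⟩
    exact topReadsFull_of_datum hnK x₀ hρ'1 ha hroomW U gJ hu₁ hW hη0 hchartTop hsa hlam0 hgrad b (rep_mem_cube_top_of_mem hk x₀ ha hroomW hT)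
  -- the top row: ✓`htop_of_knitGauge`
  have htop := htop_of_knitGauge F hnK x₀ hρ'1 ha hroomW hε₀ hε hε₁ V hV U hU gJ hu₁SU hW hc' hbudget8 hc₁ hchartTop hκfs hκf0 hsa htr htopRow hε₁l
  -- the reshaped socket, instantiated
  exact H42_of_towerTop F hnK hρ' U hε₀ hα₁ hα₂ hα3 hα4 h16 hsmallP hc₃P hsmall₁ hkb hbudget hr hr2 hwin gJ hInAk hInAx htw _ hreads htop

end Summit.QuantumFields.YangMills.Theorems.HalvingHSiteTopH42AtMember

end
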